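import Mathlib
import Summits.BirchSwinnertonDyer.BirchSwinnertonDyer.Theorems.ManinLocalTwoThreeEvenDegreeOfFrickeSignPlus
import Literature.NumberTheory.EllipticCurves.BSDRootNumberTwoSubModularityProofs
import Literature.NumberTheory.EllipticCurves.RootNumberParityProofs
import Literature.NumberTheory.EllipticCurves.CuspFormLFunctionAnalyticRankProofs
import Literature.NumberTheory.EllipticCurves.RootNumber
import HarnessLib

/-!
# Odd modular degree ⟹ root number `+1` ⟹ EVEN analytic rank (every elliptic curve over `ℚ`, globally minimal model)

Summit `BirchSwinnertonDyer`, sub-problem `BirchSwinnertonDyer`, route `ManinLocalTwoThree`; width seat `bsd-line-manin23-p2`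
(gen 9), `--supports` the crux C2 `ManinOddAtFour` (stmt-BirchSwinnertonDyer-22967).  Corollaries of the seat's
`two_dvd_modularDegree_of_rootNumber_eq_neg_one` (p659653: root number `−1` ⟹ even degree, via the `w(N)`-invariance of `φ`):
the contrapositive with `w(W) = ±1`, and the parity of the analytic rank through the tree's functional equation with sign
`w(W)` for modular curves (`hasFunctionalEquationSign_rootNumber_of_isNewformOf`, `even_analyticRank_iff_of_hasFunctionalEquationSign`).
This is the elementary half of the print floor «odd modular degree ⟹ even analytic rank» (Calegari–Emerton 2009, Thm. 1) — here
for ANY parametrisation datum at the conductor, optimal or not.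

PROVED here (no `sorry`): **`rootNumber_eq_one_of_odd_modularDegree`**, **`even_analyticRank_of_odd_modularDegree`**.
BSD is not proved by this; Manin's conjecture is not proved by this.
-/

set_option autoImplicit false
set_option linter.dupNamespace false

noncomputable section

open scoped MatrixGroups ModularForm
open CongruenceSubgroup
open Literature.NumberTheory.EllipticCurves Literature.NumberTheory.EllipticCurves.ModularForms

namespace Summit.BirchSwinnertonDyer.BirchSwinnertonDyer.Theorems.ManinLocalTwoThree

/-- **Odd modular degree ⟹ root number `+1`.** -/
theorem rootNumber_eq_one_of_odd_modularDegree (W : WeierstrassCurve ℚ) [W.IsElliptic] [W.IsGloballyMinimal]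
    [NeZero (W.conductorNorm ℤ)] (D : ModularParametrizationData W (W.conductorNorm ℤ)) (hodd : Odd D.modularDegree) :
    W.rootNumber = 1 := by
  rcases W.rootNumber_eq_one_or with h | h
  · exact h
  · exact absurd (even_iff_two_dvd.mpr (two_dvd_modularDegree_of_rootNumber_eq_neg_one W D h))
      (Nat.not_even_iff_odd.mpr hodd)

/-- **Odd modular degree ⟹ even analytic rank** (functional equation with sign `w(W) = +1`). -/
theorem even_analyticRank_of_odd_modularDegree (W : WeierstrassCurve ℚ) [W.IsElliptic] [W.IsGloballyMinimal]
    [NeZero (W.conductorNorm ℤ)] (D : ModularParametrizationData W (W.conductorNorm ℤ)) (hodd : Odd D.modularDegree) :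
    Even W.analyticRank :=
  (W.even_analyticRank_iff_of_hasFunctionalEquationSign D.isNewformOf.hasEntireLFunction
    (W.hasFunctionalEquationSign_rootNumber_of_isNewformOf D.isNewformOf)).mpr
    (rootNumber_eq_one_of_odd_modularDegree W D hodd)

end Summit.BirchSwinnertonDyer.BirchSwinnertonDyer.Theorems.ManinLocalTwoThree

end
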